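import Literature.IUT.LogThetaLattice.GlobalLGPFrobenioidsModFrakRealifiedDivisors
import Literature.IUT.LogVolume.ArithmeticDivisorsFrdBridge
import HarnessLib

/-!
# Frobenioids I, Thm. 6.4 (i): the coordinates `(Φ^rlf)^gp(L) = ArithDiv_ℝ(L)` of THE realification of the
# arithmetic divisor monoid `Φ(L)` — part 1: the coordinate embedding `Φ(L) → ⊕_v ℝ_{≥0}` and its perfection

Mochizuki, *The geometry of Frobenioids I*, Kyushu J. Math. **62** (2008), Thm. 6.4 (i), proof p. 115 l. 27–33:
"the homomorphism `(Φ^rlf)^gp(L) = ArithDiv_ℝ(L) → ℝ` given by `deg_L^arith` … the image via the natural map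
`Φ^birat(L) → Φ^rlf(L)` of `Φ^birat(L) ⊗_ℤ ℝ` in `(Φ^rlf_factor)^gp(L)` is equal to the set of elements of finite
support with arithmetic degree `0`" [cite: MochizukiFrdI2008, Thm. 6.4 (i) p.115]; Def. 2.4 (i) p. 48 (the
realification `M^rlf ⊆ M^rlf_factor = ∏_𝔭 M^rlf_𝔭`, an `ℝ_{≥0}`-semimodule with `(M^rlf)^gp` an `ℝ`-vector space)
[cite: MochizukiFrdI2008, Def. 2.4(i) p.48]; the universal property of `M^pf → M^rlf` among monoids supported by
`ℝ` is [EtTh] Lem. 3.5 (i) p. 75 (tree: abc-iut-L2-d2 `RlfUniversal.existsUnique_lift`) [cite: MochizukiEtTh2009, Lem 3.5 p.75].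

PROOF-ONLY (node FrdI:Thm6.4(i), sub-DAG row T64i/L15 interface level; seat abc-iut-L1-d2, cell abc-iut).
PART 1 of 2 (this file): the target `Q = ⊕_{v ∈ Place L} ℝ_{≥0}` and the coordinate embedding `j : Φ(L) → Q` with its
extension `j^pf` to the perfection — injective, image = the RATIONAL families, group-saturated.  PART 2
(`ArithmeticRealificationCoordinates.lean`) performs the extension to `Φ(L)^rlf` and proves the main theorem below.
For a number field `L` and THE realification `Φ(L)^rlf = IsPerfFactorial.Rlf` of the perf-factorial monoid
`Φ(L) = Multiplicative (EffArithDivisor L)` (`EffArithDivisor.isPerfFactorial`, Ex. 6.3), this file PROVES the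
identification of print, `(Φ^rlf)^gp(L) = ArithDiv_ℝ(L)`, in the following usable form
(`ArithRlfCoord.exists_rlfGp_coordinates`): there is an INJECTIVE homomorphism

  `Θ : (Φ(L)^rlf)^gp → ADiv_ℝ(L) = Place L →₀ ℝ` (abc-iut-S's `Literature.IUT.LogVolume.ADivisor L`)

which (a) restricted along `ι : Φ(L) → Φ(L)^rlf` IS the comparison `Φ(L)^gp = ArithDivisor L → ADiv_ℝ(L)` of
`ArithmeticDivisorsFrdBridge` (`ADivisor.ofArithDivisor`, so principal divisors go to principal divisors and
`deg^arith` to `deg_L`), (b) maps `Φ(L)^rlf` to EFFECTIVE real divisors, and (c) is `ℝ`-LINEAR for the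
`ℝ`-vector-space structure `IsPerfFactorial.Rlf.realSMul` of Def. 2.4 (i) (`RealificationDataCanonical`).
Construction: `Q := ⊕_{v ∈ Place L} ℝ_{≥0}` (`directSum`) is supported by `ℝ`
(`DirectSum.supports_R_of_isRMonoprime`, abc-iut-w4-d015); the coordinate embedding `j : Φ(L) → Q`
(`[L_w:ℝ]·t_w` at archimedean `w`, `n_v` at finite `v`) extends to `Φ(L)^pf → Q` (injective, image = the families
with RATIONAL finite coordinates, group-saturated) and then UNIQUELY to `θ : Φ(L)^rlf → Q`
(`RlfUniversal.existsUnique_lift`), injective by order reflection (`RlfUniversal.lift_injective`) and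
`ℝ_{≥0}`-equivariant coordinatewise (`IsPerfFactorial.Rlf.hom_nnreal_rpow`); `Θ := (Q ⊆ ADiv_ℝ(L))^gp ∘ θ^gp`.
All intermediate objects are hypotheses of the helper theorems (characterised by their coordinates), so that no
definition is introduced.  The same route was taken for the one-arrow model of [IUTchIII] Prop. 3.7 by
abc-iut-w4-d015 (`Literature.IUT.LogThetaLattice.Prop37.rlfEquivModel`); here the number field and the target
`ADiv_ℝ(L)` are those of [FrdI] Thm. 6.4 / abc-iut-L1-t3's sub-DAG rows T64i/L13–L15.
-/

noncomputable section

open scoped NNReal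

namespace Literature.AlgebraicGeometry.Frobenioids

namespace ArithRlfCoord

open Function NumberField IsDedekindDomain Literature.AnabelianGeometry.EtaleTheta Literature.IUT.LogVolume

variable (L : Type) [Field L]

/-! ### The target `Q = ⊕_{v ∈ Place L} ℝ_{≥0}` is supported by `ℝ` -/

/-- `ℝ` supports `⊕_{v ∈ Place L} ℝ_{≥0}` (Def. 2.4 (ii)(c): perfect, perf-factorial, every `M_𝔭 ≅ ℝ_{≥0}`
`ℝ`-monoprime). [cite: MochizukiFrdI2008, Def. 2.4(ii) p.48] -/
theorem supports_R_realDirectSum :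
    Supports (directSum fun _ : Place L => Multiplicative ℝ≥0) MonoidType.R := by
  classical
  exact DirectSum.supports_R_of_isRMonoprime fun _ => isRMonoprime_multiplicative_nnreal

/-- `⊕_{v ∈ Place L} ℝ_{≥0}` is perfect. [cite: MochizukiFrdI2008, §0 p.11] -/
theorem isPerfect_realDirectSum : IsPerfect (directSum fun _ : Place L => Multiplicative ℝ≥0) :=
  (supports_R_realDirectSum L).1

/-- Powers in `⊕_{v ∈ Place L} ℝ_{≥0} ⊆ ArithDiv_ℝ(L)`, coordinatewise in `ℝ_{≥0}`: `(x^n)_p = n · x_p`.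
[cite: MochizukiFrdI2008, Thm. 6.4 (i) p.115] -/
theorem toAdd_coe_pow (x : directSum fun _ : Place L => Multiplicative ℝ≥0) (n : ℕ) (p : Place L) :
    Multiplicative.toAdd ((↑(x ^ n) : Place L → Multiplicative ℝ≥0) p) =
      n * Multiplicative.toAdd ((x : Place L → Multiplicative ℝ≥0) p) := by
  rw [DirectSum.coe_pow, Pi.pow_apply, toAdd_pow, nsmul_eq_mul]

/-- Products in `⊕_{v ∈ Place L} ℝ_{≥0} ⊆ ArithDiv_ℝ(L)`, coordinatewise in `ℝ_{≥0}`: `(xy)_p = x_p + y_p`.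
[cite: MochizukiFrdI2008, Thm. 6.4 (i) p.115] -/
theorem toAdd_coe_mul (x y : directSum fun _ : Place L => Multiplicative ℝ≥0) (p : Place L) :
    Multiplicative.toAdd ((↑(x * y) : Place L → Multiplicative ℝ≥0) p) =
      Multiplicative.toAdd ((x : Place L → Multiplicative ℝ≥0) p) +
        Multiplicative.toAdd ((y : Place L → Multiplicative ℝ≥0) p) := by
  rw [DirectSum.coe_mul, Pi.mul_apply, toAdd_mul]

variable {L} [NumberField L]

/-! ### The coordinate embedding `j : Φ(L) → Q` (characterised by its coordinates) -/

section Coord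

variable (j : Multiplicative (EffArithDivisor L) →* directSum fun _ : Place L => Multiplicative ℝ≥0)
  (hj₁ : ∀ (D : EffArithDivisor L) (w : InfinitePlace L),
    Multiplicative.toAdd ((j (Multiplicative.ofAdd D) : Place L → Multiplicative ℝ≥0) (Sum.inl w)) =
      (w.mult : ℝ≥0) * D.2 w)
  (hj₂ : ∀ (D : EffArithDivisor L) (v : HeightOneSpectrum (𝓞 L)),
    Multiplicative.toAdd ((j (Multiplicative.ofAdd D) : Place L → Multiplicative ℝ≥0) (Sum.inr v)) =
      ((D.1 (FinitePlace.mk v) : ℕ) : ℝ≥0))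
include hj₁ hj₂

/-- The coordinate embedding `j : Φ(L) → ⊕_v ℝ_{≥0}` (`[L_w:ℝ]·t_w` at archimedean `w`, `n_v` at finite `v`)
is injective. [cite: MochizukiFrdI2008, Ex. 6.3 p.113] -/
theorem coord_injective : Injective j := by
  intro x y hxy
  induction x using Multiplicative.ofAdd.surjective.forall.mpr ?_
  · rename_i D
    induction y using Multiplicative.ofAdd.surjective.forall.mpr ?_
    · rename_i E
      congr 1
      refine Prod.ext (Finsupp.ext fun w => ?_) (funext fun w => ?_)
      · have h := hj₂ D (FinitePlace.maximalIdeal w)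
        rw [hxy, hj₂ E, FinitePlace.mk_maximalIdeal] at h
        exact_mod_cast h.symm
      · have h := hj₁ D w
        rw [hxy, hj₁ E] at h
        have hm : (w.mult : ℝ≥0) ≠ 0 := by exact_mod_cast InfinitePlace.mult_ne_zero
        exact (mul_left_cancel₀ hm h).symm

omit hj₁ hj₂ in
/-- `j ∘ of = (Q ≅ Q^pf)⁻¹ ∘ j^pf ∘ of`: the extension `j^pf : Φ(L)^pf → Q` of `j` to the perfection (`Q` perfect)
restricts to `j`. [cite: MochizukiFrdI2008, §0 p.11] -/
theorem coordPf_of (D : Multiplicative (EffArithDivisor L)) :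
    ((isPerfect_realDirectSum L).equivPerfection.symm.toMonoidHom.comp (Perfection.map j))
        (Perfection.of _ D) = j D := by
  show (isPerfect_realDirectSum L).equivPerfection.symm (Perfection.map j (Perfection.of _ D)) = _
  apply (isPerfect_realDirectSum L).equivPerfection.injective
  rw [MulEquiv.apply_symm_apply, IsPerfect.equivPerfection_apply]
  exact DFunLike.congr_fun (Perfection.map_comp_of j) D

omit hj₁ hj₂ in
/-- `j^pf (a^{1/n})^n = j a`. [cite: MochizukiFrdI2008, §0 p.11] -/
theorem coordPf_mk_pow (D : Multiplicative (EffArithDivisor L)) (n : ℕ+) :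
    ((isPerfect_realDirectSum L).equivPerfection.symm.toMonoidHom.comp (Perfection.map j))
        (Perfection.mk D n) ^ (n : ℕ) = j D := by
  rw [← map_pow, Perfection.mk_pow_self, coordPf_of j]

/-- `j^pf` is injective. [cite: MochizukiFrdI2008, §0 p.11] -/
theorem coordPf_injective :
    Injective ((isPerfect_realDirectSum L).equivPerfection.symm.toMonoidHom.comp (Perfection.map j)) :=
  (isPerfect_realDirectSum L).equivPerfection.symm.injective.comp
    (Perfection.map_injective j (coord_injective j hj₁ hj₂))

omit hj₁ in
/-- **The image of `Φ(L)^pf` in `Q` consists of RATIONAL families**: the finite coordinates of `j^pf(a^{1/n})` lie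
in `(1/n)·ℕ`. [cite: MochizukiFrdI2008, §0 p.11] -/
theorem exists_rat_of_mem_mrange {y : directSum fun _ : Place L => Multiplicative ℝ≥0}
    (hy : y ∈ MonoidHom.mrange
      ((isPerfect_realDirectSum L).equivPerfection.symm.toMonoidHom.comp (Perfection.map j))) :
    ∃ n : ℕ+, ∀ v : HeightOneSpectrum (𝓞 L), ∃ k : ℕ,
      Multiplicative.toAdd ((y : Place L → Multiplicative ℝ≥0) (Sum.inr v)) = (k : ℝ≥0) / n := by
  obtain ⟨x, rfl⟩ := hy
  obtain ⟨⟨D, n⟩, rfl⟩ := Perfection.mk_surjective x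
  refine ⟨n, fun v => ⟨(Multiplicative.toAdd D).1 (FinitePlace.mk v), ?_⟩⟩
  have h := congrArg (fun z : directSum (fun _ : Place L => Multiplicative ℝ≥0) =>
    Multiplicative.toAdd ((z : Place L → Multiplicative ℝ≥0) (Sum.inr v))) (coordPf_mk_pow j D n)
  beta_reduce at h
  rw [toAdd_coe_pow, ← ofAdd_toAdd D, hj₂] at h
  have hn : (0 : ℝ≥0) < (n : ℕ) := by exact_mod_cast n.pos
  rw [eq_div_iff hn.ne', mul_comm]
  rw [ofAdd_toAdd] at h
  exact h

/-- The effective arithmetic divisor with prescribed natural finite coordinates `k` (inside the support of `y`)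
and archimedean coordinates `n · y_w / [L_w:ℝ]`: its image under `j` is `y^n`. [cite: MochizukiFrdI2008, Ex. 6.3 p.113] -/
theorem exists_coord_eq_pow (y : directSum fun _ : Place L => Multiplicative ℝ≥0) (n : ℕ+)
    (hk : ∀ v : HeightOneSpectrum (𝓞 L), ∃ k : ℕ,
      Multiplicative.toAdd ((y : Place L → Multiplicative ℝ≥0) (Sum.inr v)) = (k : ℝ≥0) / n) :
    ∃ D : Multiplicative (EffArithDivisor L), j D = y ^ (n : ℕ) := by
  choose k hk using hk
  have hn : (0 : ℝ≥0) < (n : ℕ) := by exact_mod_cast n.pos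
  -- the ℕ-valued finite part, finitely supported inside the support of `y`
  have hfin : (Function.support fun w : FinitePlace L => k (FinitePlace.maximalIdeal w)).Finite := by
    refine ((DirectSum.finite_dsupp y).preimage
      (f := fun w : FinitePlace L => (Sum.inr (FinitePlace.maximalIdeal w) : Place L)) ?_).subset ?_
    · exact (Sum.inr_injective.comp FinitePlace.maximalIdeal_injective).injOn
    · intro w hw
      rw [Function.mem_support] at hw
      rw [Set.mem_preimage, mem_dsupp_iff]
      intro h1
      have h := hk (FinitePlace.maximalIdeal w)
      rw [h1, toAdd_one] at h
      exact hw (by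
        have := (div_eq_zero_iff.mp h.symm).resolve_right hn.ne'
        exact_mod_cast this)
  let N : FinitePlace L →₀ ℕ := Finsupp.ofSupportFinite _ hfin
  let t : InfinitePlace L → ℝ≥0 := fun w =>
    (n : ℕ) * Multiplicative.toAdd ((y : Place L → Multiplicative ℝ≥0) (Sum.inl w)) / (w.mult : ℝ≥0)
  refine ⟨Multiplicative.ofAdd (N, t), Subtype.ext (funext fun p => ?_)⟩
  apply Multiplicative.toAdd.injective
  rw [toAdd_coe_pow]
  rcases p with w | v
  · rw [hj₁]
    have hm : (w.mult : ℝ≥0) ≠ 0 := by exact_mod_cast InfinitePlace.mult_ne_zero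
    show (w.mult : ℝ≥0) * ((n : ℕ) * Multiplicative.toAdd ((y : Place L → Multiplicative ℝ≥0) (Sum.inl w)) /
      (w.mult : ℝ≥0)) = _
    rw [mul_div_cancel₀ _ hm]
  · rw [hj₂]
    show ((Finsupp.ofSupportFinite (fun w : FinitePlace L => k (FinitePlace.maximalIdeal w)) hfin
      (FinitePlace.mk v) : ℕ) : ℝ≥0) = _
    rw [Finsupp.ofSupportFinite_coe, FinitePlace.maximalIdeal_mk, hk v, mul_div_cancel₀ _ hn.ne']

/-- … hence a rational family IS in the image of `Φ(L)^pf` (`Q` has unique `n`-th roots).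
[cite: MochizukiFrdI2008, §0 p.11] -/
theorem mem_mrange_of_rat {y : directSum fun _ : Place L => Multiplicative ℝ≥0} (n : ℕ+)
    (hk : ∀ v : HeightOneSpectrum (𝓞 L), ∃ k : ℕ,
      Multiplicative.toAdd ((y : Place L → Multiplicative ℝ≥0) (Sum.inr v)) = (k : ℝ≥0) / n) :
    y ∈ MonoidHom.mrange
      ((isPerfect_realDirectSum L).equivPerfection.symm.toMonoidHom.comp (Perfection.map j)) := by
  obtain ⟨D, hD⟩ := exists_coord_eq_pow j hj₁ hj₂ y n hk
  refine ⟨Perfection.mk D n, ((isPerfect_realDirectSum L).bijective_pow n n.pos).1 ?_⟩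
  show ((isPerfect_realDirectSum L).equivPerfection.symm.toMonoidHom.comp (Perfection.map j))
      (Perfection.mk D n) ^ (n : ℕ) = y ^ (n : ℕ)
  rw [coordPf_mk_pow j, hD]

/-- **The image of `Φ(L)^pf` in `Q` is GROUP-SATURATED**: `q · b = a` with `a, b` rational forces `q` rational
(differences of rationals are rational; `q` is effective). [cite: MochizukiEtTh2009, §0 p.8] -/
theorem isGroupSaturated_mrange_coordPf :
    IsGroupSaturated (MonoidHom.mrange
      ((isPerfect_realDirectSum L).equivPerfection.symm.toMonoidHom.comp (Perfection.map j))) := by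
  rw [isGroupSaturated_iff']
  intro q a ha b hb hqb
  obtain ⟨n₁, h₁⟩ := exists_rat_of_mem_mrange j hj₂ ha
  obtain ⟨n₂, h₂⟩ := exists_rat_of_mem_mrange j hj₂ hb
  refine mem_mrange_of_rat j hj₁ hj₂ (n₁ * n₂) fun v => ?_
  obtain ⟨k₁, hk₁⟩ := h₁ v
  obtain ⟨k₂, hk₂⟩ := h₂ v
  -- in `ℝ`: `q_v = k₁/n₁ - k₂/n₂ ≥ 0`
  have hq0 : (0 : ℝ) ≤ ((Multiplicative.toAdd ((q : Place L → Multiplicative ℝ≥0) (Sum.inr v)) : ℝ≥0) : ℝ) :=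
    NNReal.coe_nonneg _
  have hqcls : ((Multiplicative.toAdd ((q : Place L → Multiplicative ℝ≥0) (Sum.inr v)) : ℝ≥0) : ℝ) =
      (k₁ : ℝ) / n₁ - (k₂ : ℝ) / n₂ := by
    have h := congrArg (fun z : directSum (fun _ : Place L => Multiplicative ℝ≥0) =>
      ((Multiplicative.toAdd ((z : Place L → Multiplicative ℝ≥0) (Sum.inr v)) : ℝ≥0) : ℝ)) hqb
    beta_reduce at h
    rw [toAdd_coe_mul, hk₂, NNReal.coe_add] at h
    have hk₁' : ((Multiplicative.toAdd ((a : Place L → Multiplicative ℝ≥0) (Sum.inr v)) : ℝ≥0) : ℝ) =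
        (k₁ : ℝ) / n₁ := by rw [hk₁]; push_cast; rfl
    have hk₂' : (((k₂ : ℝ≥0) / n₂ : ℝ≥0) : ℝ) = (k₂ : ℝ) / n₂ := by push_cast; rfl
    rw [hk₁', hk₂'] at h
    linarith
  have hn₁ : (0 : ℝ) < (n₁ : ℕ) := by exact_mod_cast n₁.pos
  have hn₂ : (0 : ℝ) < (n₂ : ℕ) := by exact_mod_cast n₂.pos
  -- the integer `k₁ n₂ - k₂ n₁` is nonnegative
  have hint : (0 : ℤ) ≤ (k₁ : ℤ) * n₂ - (k₂ : ℤ) * n₁ := by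
    have h' : (0 : ℝ) ≤ ((k₁ : ℝ) * n₂ - (k₂ : ℝ) * n₁) / ((n₁ : ℝ) * n₂) := by
      rw [hqcls] at hq0
      have : (k₁ : ℝ) / n₁ - (k₂ : ℝ) / n₂ = ((k₁ : ℝ) * n₂ - (k₂ : ℝ) * n₁) / ((n₁ : ℝ) * n₂) := by
        field_simp
      rwa [this] at hq0
    have h'' : (0 : ℝ) ≤ (k₁ : ℝ) * n₂ - (k₂ : ℝ) * n₁ :=
      (div_nonneg_iff.mp h').elim (fun h => h.1) fun h => by
        exfalso; exact not_lt.mpr h.2 (mul_pos hn₁ hn₂)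
    exact_mod_cast h''
  refine ⟨((k₁ : ℤ) * n₂ - (k₂ : ℤ) * n₁).toNat, ?_⟩
  apply NNReal.coe_injective
  rw [hqcls]
  have hcast : ((((k₁ : ℤ) * n₂ - (k₂ : ℤ) * n₁).toNat : ℕ) : ℝ) = (k₁ : ℝ) * n₂ - (k₂ : ℝ) * n₁ := by
    have := Int.toNat_of_nonneg hint
    exact_mod_cast this
  push_cast
  rw [hcast]
  rw [div_sub_div _ _ hn₁.ne' hn₂.ne']
  ring

end Coord

end ArithRlfCoord

end Literature.AlgebraicGeometry.Frobenioids

end
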